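import Literature.AlgebraicGeometry.Frobenioids.PreFrobenioidDataOfFunctor
import HarnessLib

/-!
# Frobenioids I, Definition 1.1 (iv): from the operations `(Base, Φ, Div, deg_Fr)` back to a functor
# `C → F_Φ` — the converse of the adapter `PreFrobenioidData.ofFunctor`

Mochizuki, *The geometry of Frobenioids I: the general theory*, Kyushu J. Math. **62** (2008), Def. 1.1
(iii), (iv) p. 20 [cite: MochizukiFrdI2008, Def. 1.1 (iv) p.20]: a pre-Frobenioid structure on `C` is a
functor `C → F_Φ`; its operations `Base(-)`, `Div(-)`, `deg_Fr(-)` with the laws of Remark 1.1.1 are the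
cell's statement interface `PreFrobenioidData` (seat abc-iut-L1-t3), and `PreFrobenioidData.ofFunctor Φ F`
(`PreFrobenioidDataOfFunctor.lean`) extracts them from a functor. This file supplies the converse direction,
needed whenever a category is built at the level of operations only — notably the perfection `C^pf`
(`Perfection.ops hF`, seat abc-iut-L1-d9), whose functor `C^pf → F_{Φ^pf}` of Prop. 3.2 (i) is then
`(Perfection.ops hF).toFunctor` (row `FrdI:Prop3.2(iii)-frobenioid` of the abc-iut cell):

* `PreFrobenioidData.monFunctor S : Dᵒᵖ ⥤ CommMonCat` — the divisor monoids `X ↦ Φ(X)` with the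
  pull-back maps, as a contravariant functor;
* `PreFrobenioidData.toFunctor S : C ⥤ ElemFrobenioid S.monFunctor` — `A ↦ Base(A)`,
  `φ ↦ (Base φ, Div φ, deg_Fr φ)`; functoriality IS the pair of laws `div_comp`, `degFr_comp` of Remark
  1.1.1 (the composition law of `F_Φ`, Def. 1.1 (iii));
* round trip: the operations of `S.toFunctor` are those of `S` (`rfl` on `Base`, `Div`, `deg_Fr`, `Φ`,
  pull-backs).
-/

namespace Literature.AlgebraicGeometry.Frobenioids

open CategoryTheory Opposite

universe w v v' u u'

namespace PreFrobenioidData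

variable {C : Type u} [Category.{v} C] {D : Type u'} [Category.{v'} D] (S : PreFrobenioidData.{w} C D)

/-- The divisor monoids of `S` as a contravariant functor `Φ_S : Dᵒᵖ → (commutative monoids)`.
[cite: MochizukiFrdI2008, Def. 1.1 (iv) p.20] -/
noncomputable def monFunctor : Dᵒᵖ ⥤ CommMonCat.{w} where
  obj X := CommMonCat.of (S.Mon X.unop)
  map f := CommMonCat.ofHom (S.pull f.unop)
  map_id X := by ext x; exact S.pull_id X.unop x
  map_comp f g := by ext x; exact S.pull_comp g.unop f.unop x

/-- The functor `C → F_{Φ_S}`, `A ↦ Base(A)`, `φ ↦ (Base φ, Div φ, deg_Fr φ)` determined by the operations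
`S` (FrdI Def. 1.1 (iv)). [cite: MochizukiFrdI2008, Def. 1.1 (iv) p.20] -/
noncomputable def toFunctor : C ⥤ ElemFrobenioid S.monFunctor where
  obj A := ElemFrobenioid.of S.monFunctor (S.base.obj A)
  map φ := ⟨S.base.map φ, S.div φ, S.degFr φ⟩
  map_id A := by
    refine ElemFrobenioid.Hom.ext ?_ ?_ ?_
    · exact S.base.map_id A
    · exact S.div_id A
    · exact S.degFr_id A
  map_comp φ ψ := by
    refine ElemFrobenioid.Hom.ext ?_ ?_ ?_
    · exact S.base.map_comp φ ψ
    · exact S.div_comp φ ψ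
    · exact S.degFr_comp φ ψ

/-- Round trip: the operations of `S.toFunctor` are `S`. [cite: MochizukiFrdI2008, Def. 1.1 (iv) p.20] -/
theorem ofFunctor_toFunctor_degFr {A B : C} (φ : A ⟶ B) :
    (ofFunctor S.monFunctor S.toFunctor).degFr φ = S.degFr φ := rfl

/-- Round trip on `Div`. [cite: MochizukiFrdI2008, Def. 1.1 (iv) p.20] -/
theorem ofFunctor_toFunctor_div {A B : C} (φ : A ⟶ B) :
    (ofFunctor S.monFunctor S.toFunctor).div φ = S.div φ := rfl

/-- Round trip on `Base`. [cite: MochizukiFrdI2008, Def. 1.1 (iv) p.20] -/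
theorem ofFunctor_toFunctor_base_map {A B : C} (φ : A ⟶ B) :
    (ofFunctor S.monFunctor S.toFunctor).base.map φ = S.base.map φ := rfl

/-- Round trip on objects: `Base` of `S.toFunctor` at an object is `S.base`. [cite: MochizukiFrdI2008, Def. 1.1 (iv) p.20] -/
theorem ofFunctor_toFunctor_base_obj (A : C) : (ofFunctor S.monFunctor S.toFunctor).base.obj A = S.base.obj A := rfl

/-- Round trip on the divisor monoids: `Φ_S(X) = S.Mon X`. [cite: MochizukiFrdI2008, Def. 1.1 (iv) p.20] -/
theorem ofFunctor_toFunctor_mon (X : D) : (ofFunctor S.monFunctor S.toFunctor).Mon X = S.Mon X := rfl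

/-- Round trip on pull-backs. [cite: MochizukiFrdI2008, Def. 1.1 (iv) p.20] -/
theorem ofFunctor_toFunctor_pull {X Y : D} (f : Y ⟶ X) (x : S.Mon X) :
    (ofFunctor S.monFunctor S.toFunctor).pull f x = S.pull f x := rfl

/-- The base functor of `S.toFunctor` is `S.base` (as functors). [cite: MochizukiFrdI2008, Def. 1.1 (iv) p.20] -/
theorem baseFunctor_toFunctor : PreFrobenioid.baseFunctor S.toFunctor = S.base := rfl

/-- **Round trip, as data**: the operations of the functor `S.toFunctor` ARE `S` — so every notion of
Def. 1.2 stated over `S` (the `PreFrobenioidData.IsX S` predicates) is literally the corresponding notion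
`PreFrobenioid.IsX S.toFunctor` through the `ofFunctor_isX` lemmas of `PreFrobenioidDataOfFunctor.lean`.
[cite: MochizukiFrdI2008, Def. 1.1 (iv) p.20] -/
theorem ofFunctor_toFunctor : ofFunctor S.monFunctor S.toFunctor = S := rfl

/-- Example of the transfer: pre-steps of `S.toFunctor` are the pre-steps of `S`. [cite: MochizukiFrdI2008, Def. 1.2 (iii) p.22] -/
theorem isPreStep_toFunctor_iff {A B : C} (φ : A ⟶ B) :
    PreFrobenioid.IsPreStep S.toFunctor φ ↔ S.IsPreStep φ := Iff.rfl

/-- Frobenius-type arrows of `S.toFunctor` are those of `S`. [cite: MochizukiFrdI2008, Def. 1.2 (iii) p.22] -/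
theorem isFrobeniusType_toFunctor_iff {A B : C} (φ : A ⟶ B) :
    PreFrobenioid.IsFrobeniusType S.toFunctor φ ↔ S.IsFrobeniusType φ := by
  rw [← ofFunctor_isFrobeniusType S.toFunctor φ]
  rfl

end PreFrobenioidData

end Literature.AlgebraicGeometry.Frobenioids
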